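import Summits.MatrixMultiplication.MatrixMultiplication.Theorems.SoloBlindCwBasisGroupNoGo
import HarnessLib

/-!
# The window of CW-basis group-degeneration certificates for `T_{cw,2}^{⊠N}`

Companion to `SoloBlindCwBasisGroupNoGo`. A *CW-basis group degeneration* of the `N`-th
Kronecker power `T^{⊠N}` of the small Coppersmith–Winograd tensor `T = T_{cw,2}` in a finite
abelian group `H` consists of maps `α β γ : (Fin N → Fin 3) → H`, an element `u : H`, weights
`ω₁ ω₂ ω₃ : (Fin N → Fin 3) → ℕ` and a level `h : ℕ` such that

* (F) every support triple `(a,b,c)` of `T^{⊠N}` (coordinatewise in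
  `S_cw = {(0,i,i),(i,0,i),(i,i,0) : i = 1,2}`) satisfies `α a + β b + γ c = u` with total weight
  exactly `h`, and
* (C) every other solution of `α a + β b + γ c = u` has total weight `> h`.

This file records both ends of the window such certificates live in:

* `algBorderRank_kroneckerPow_cwTensor_le_card_of_cwDegeneration` — the **upper-bound rung**
  (three maps, three weights): the data exhibit `T^{⊠N}` as the lowest-order part of a restriction
  of the structure tensor of `ℂ[H]`, hence `bR(T^{⊠N}) ≤ |H|` (the one-map, xyz-support analogue
  in the tree is `algBorderRank_kroneckerPow_cwTensor_le_card_of_degeneration`);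
* `cwDegeneration_certificate_window` — together with the no-go theorem
  `four_pow_le_card_of_cwDegeneration` of the companion file: every such certificate proves
  `bR(T^{⊠N}) ≤ |H|` for some `|H| ≥ 4^N = bR`-trivial bound, i.e. the format can never certify
  `R̃(T_{cw,2}) < 4`, for any `N`;
* `exists_cwDegeneration_card_eq_four_pow` — the window is not empty and its lower end is
  attained: the product realization in `(ℤ/4)^N` (weights `0`).

References: Bürgisser–Clausen–Shokrollahi, *Algebraic Complexity Theory* (1997), §15.4–15.5
(structure tensors of group algebras, degeneration order); Alman–Vassilevska Williams,
*Limits on all known (and some unknown) approaches to matrix multiplication*, arXiv:1810.08671, §6–7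
(group tensors `T_G ≅ ⟨|G|⟩` for abelian `G`, monomial degenerations of `T_G` to CW tensors).
The statements tagged `[new]` are this seat's (solo-MatrixMultiplication-blind, 2026-08-20).
-/

set_option linter.dupNamespace false

open scoped BigOperators
open Literature.Computability.AlgebraicComplexity

namespace Summit.MatrixMultiplication.MatrixMultiplication.Theorems

/-- **Upper-bound rung, CW basis (three maps, three weights).** A CW-basis group degeneration of
`T_{cw,2}^{⊠N}` in `H` gives `bR(T_{cw,2}^{⊠N}) ≤ |H|`. [new] -/
theorem algBorderRank_kroneckerPow_cwTensor_le_card_of_cwDegeneration {N : ℕ} {H : Type*}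
    [AddCommGroup H] [Fintype H] [DecidableEq H] (α β γ : (Fin N → Fin 3) → H) (u : H)
    (ω₁ ω₂ ω₃ : (Fin N → Fin 3) → ℕ) (h : ℕ)
    (hsupp : ∀ a b c : Fin N → Fin 3, (∀ i, cwAt (a i) (b i) (c i) = true) →
      α a + β b + γ c = u ∧ ω₁ a + ω₂ b + ω₃ c = h)
    (hcut : ∀ a b c : Fin N → Fin 3, α a + β b + γ c = u →
      ¬ (∀ i, cwAt (a i) (b i) (c i) = true) → h < ω₁ a + ω₂ b + ω₃ c) :
    algBorderRank (kroneckerPow (cwTensor ℂ 2) N) ≤ Fintype.card H := by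
  have h2 : kroneckerPow (cwTensor ℂ 2) N = fun a b c => if ω₁ a + ω₂ b + ω₃ c = h then
      (if α a + β b + γ c = u then (1 : ℂ) else 0) else 0 := by
    rw [← cwTwoPow_inline_eq]
    funext a b c
    by_cases hall : ∀ i, cwAt (a i) (b i) (c i) = true
    · obtain ⟨hs, hw⟩ := hsupp a b c hall
      rw [if_pos hw, if_pos hs]
      exact Finset.prod_eq_one fun i _ => by rw [if_pos ((cwAt_iff _ _ _).mp (hall i))]
    · have lhs0 : (∏ i, (if (a i = 0 ∧ b i = c i ∧ b i ≠ 0) ∨ (b i = 0 ∧ a i = c i ∧ a i ≠ 0) ∨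
          (c i = 0 ∧ a i = b i ∧ a i ≠ 0) then (1 : ℂ) else 0)) = 0 := by
        obtain ⟨i, hi⟩ := not_forall.mp hall
        exact Finset.prod_eq_zero (Finset.mem_univ i)
          (if_neg fun hP => hi ((cwAt_iff _ _ _).mpr hP))
      rw [lhs0]
      by_cases hs : α a + β b + γ c = u
      · have := hcut a b c hs hall
        rw [if_neg (by omega)]
      · rw [if_neg hs]
        simp
  rw [h2]
  refine (algBorderRank_initialPart_le_tensorRank
    (fun a b c : Fin N → Fin 3 => if α a + β b + γ c = u then (1 : ℂ) else 0) ω₁ ω₂ ω₃ h ?_).trans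
    (tensorRank_indicator₃_le_card α β γ u)
  intro a b c hlt
  by_cases hs : α a + β b + γ c = u
  · exfalso
    by_cases hall : ∀ i, cwAt (a i) (b i) (c i) = true
    · have := (hsupp a b c hall).2
      omega
    · have := hcut a b c hs hall
      omega
  · exact if_neg hs

/-- **The window.** Every CW-basis group-degeneration certificate for `T_{cw,2}^{⊠N}` proves
`bR(T_{cw,2}^{⊠N}) ≤ |H|` with `|H| ≥ 4^N`: the format is sound but can never beat the trivial
bound `bR(T_{cw,2}^{⊠N}) ≤ 4^N`, for any `N` and any finite abelian `H`. [new] -/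
theorem cwDegeneration_certificate_window {N : ℕ} {H : Type*}
    [AddCommGroup H] [Fintype H] [DecidableEq H] (α β γ : (Fin N → Fin 3) → H) (u : H)
    (ω₁ ω₂ ω₃ : (Fin N → Fin 3) → ℕ) (h : ℕ)
    (hsupp : ∀ a b c : Fin N → Fin 3, (∀ i, cwAt (a i) (b i) (c i) = true) →
      α a + β b + γ c = u ∧ ω₁ a + ω₂ b + ω₃ c = h)
    (hcut : ∀ a b c : Fin N → Fin 3, α a + β b + γ c = u →
      ¬ (∀ i, cwAt (a i) (b i) (c i) = true) → h < ω₁ a + ω₂ b + ω₃ c) :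
    algBorderRank (kroneckerPow (cwTensor ℂ 2) N) ≤ Fintype.card H ∧ 4 ^ N ≤ Fintype.card H :=
  ⟨algBorderRank_kroneckerPow_cwTensor_le_card_of_cwDegeneration α β γ u ω₁ ω₂ ω₃ h hsupp hcut,
    four_pow_le_card_of_cwDegeneration α β γ u ω₁ ω₂ ω₃ h hsupp hcut⟩

/-- **The lower end is attained.** The product realization in `(ℤ/4)^N` (all weights `0`) is a
CW-basis group degeneration with `|H| = 4^N`. [new] -/
theorem exists_cwDegeneration_card_eq_four_pow (N : ℕ) :
    ∃ (α β γ : (Fin N → Fin 3) → (Fin N → ZMod 4)) (u : Fin N → ZMod 4)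
      (ω₁ ω₂ ω₃ : (Fin N → Fin 3) → ℕ) (h : ℕ),
      (∀ a b c : Fin N → Fin 3, (∀ i, cwAt (a i) (b i) (c i) = true) →
        α a + β b + γ c = u ∧ ω₁ a + ω₂ b + ω₃ c = h) ∧
      (∀ a b c : Fin N → Fin 3, α a + β b + γ c = u →
        ¬ (∀ i, cwAt (a i) (b i) (c i) = true) → h < ω₁ a + ω₂ b + ω₃ c) ∧
      Fintype.card (Fin N → ZMod 4) = 4 ^ N := by
  obtain ⟨α, β, γ, u, hiff⟩ := cwRealization_zmod4_pow N
  refine ⟨α, β, γ, u, fun _ => 0, fun _ => 0, fun _ => 0, 0, fun a b c habc => ⟨(hiff a b c).mpr habc, rfl⟩,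
    fun a b c hs hn => (hn ((hiff a b c).mp hs)).elim, ?_⟩
  simp [ZMod.card]

/-- **Corollary (the CW-basis group route to `R̃(T_{cw,2}) < 4` is closed).** The minimum of `|H|`
over all CW-basis group degenerations of `T_{cw,2}^{⊠N}` is exactly `4^N`; in particular no such
certificate gives `bR(T_{cw,2}^{⊠N}) < 4^N` for any `N`. Stated as: `4^N` is a lower bound and is
attained. [new] -/
theorem cwDegeneration_min_card_eq_four_pow (N : ℕ) :
    (∀ {H : Type} [AddCommGroup H] [Fintype H] (α β γ : (Fin N → Fin 3) → H) (u : H)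
      (ω₁ ω₂ ω₃ : (Fin N → Fin 3) → ℕ) (h : ℕ),
      (∀ a b c : Fin N → Fin 3, (∀ i, cwAt (a i) (b i) (c i) = true) →
        α a + β b + γ c = u ∧ ω₁ a + ω₂ b + ω₃ c = h) →
      (∀ a b c : Fin N → Fin 3, α a + β b + γ c = u →
        ¬ (∀ i, cwAt (a i) (b i) (c i) = true) → h < ω₁ a + ω₂ b + ω₃ c) →
      4 ^ N ≤ Fintype.card H) ∧
    ∃ (α β γ : (Fin N → Fin 3) → (Fin N → ZMod 4)) (u : Fin N → ZMod 4)
      (ω₁ ω₂ ω₃ : (Fin N → Fin 3) → ℕ) (h : ℕ),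
      (∀ a b c : Fin N → Fin 3, (∀ i, cwAt (a i) (b i) (c i) = true) →
        α a + β b + γ c = u ∧ ω₁ a + ω₂ b + ω₃ c = h) ∧
      (∀ a b c : Fin N → Fin 3, α a + β b + γ c = u →
        ¬ (∀ i, cwAt (a i) (b i) (c i) = true) → h < ω₁ a + ω₂ b + ω₃ c) ∧
      Fintype.card (Fin N → ZMod 4) = 4 ^ N :=
  ⟨fun α β γ u ω₁ ω₂ ω₃ h hsupp hcut =>
      four_pow_le_card_of_cwDegeneration α β γ u ω₁ ω₂ ω₃ h hsupp hcut,
    exists_cwDegeneration_card_eq_four_pow N⟩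

end Summit.MatrixMultiplication.MatrixMultiplication.Theorems
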